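import Literature.AlgebraicGeometry.Resolution.QuadraticTransformWeakTransform

/-!
# The colength of the weak transform drops at every point of the chart (Giraud 2.1.1, Kodiyalam 4.5)

Helper file for the stub `length_quotient_weakTransform_map_lt_of_not_le` (U1, the
hypothesis-free colength drop) of the line `pfaff-line-log-final-forms` (crux
`Valuative.LuAlphaPTorsor`, item `stmt-ResolutionOfSingularities-0641`).

Setting: `(R, 𝔪 = (x, y))` a two-dimensional regular local subring of the field `K`,
`A = R[y/x] ⊆ K` the chart of the blowing up of the closed point (`chartAdjoin`, structure map
`ι = chartIncl x y`, `𝔪A = xA`, `A/xA ≅ κ[X]`), `J ⊆ 𝔪ʳ`, `J ⊄ 𝔪ʳ⁺¹` an ideal of finite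
colength and `Jᴬ = (JA : xʳ)` its weak transform (`weakTransformChart`, `JA = xʳ Jᴬ`). The tree's
`length_quotient_weakTransform_map_lt` (Huneke–Swanson 14.3.4) proves
`λ(A_Q / Jᴬ A_Q) < λ_R(R/J)` under the genericity hypothesis that some `f ∈ J` of order `r` has
`f ∉ (x) + 𝔪ʳ⁺¹`, which over a finite residue field cannot always be arranged by a change of
coordinates. Here the hypothesis is removed (Giraud 1983, Lemme 2.1.1; Kodiyalam 1995, Thm. 4.5):

* `length_quotient_transform_lt_of_forall_exists` — the abstract Huneke–Swanson 14.3.4 with the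
  surjectivity of `𝔪ʳ → xʳS/JS` as a HYPOTHESIS: `S/Jˢ ≅ xʳS/JS` (multiplication by `xʳ`) is,
  as an `R`-module, a quotient of `𝔪ʳ/J ⊊ R/J`;
* `exists_eq_mul_add_add_of_degree_le` — **division by the initial form**: if `P ∈ A` reduces to a
  non-zero `F̄ ∈ κ[X]` of degree `≤ r`, then every `a ∈ A` is `a = Pq + s + xa'` with
  `xʳ s ∈ ι(𝔪ʳ)` (Euclidean division of `ā` by `F̄`; the remainder has degree `< r`, and
  `xʳ (y/x)ⁱ = ι(xʳ⁻ⁱ yⁱ)` for `i ≤ r`);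
* `exists_pow_mul_sub_mem_map` — hence, for `f ∈ J ∖ 𝔪ʳ⁺¹` (`ι f = xʳ P`, `F̄ ≠ 0` as `𝔪ʳ⁺¹` is
  contracted from `A`): `xʳA ⊆ JA + ι(𝔪ʳ) + xʳ⁺ⁿA` for all `n`, and `xᴺ ∈ J` for `N ≫ 0`
  (`R/J` Artinian), so `xʳA ⊆ JA + ι(𝔪ʳ)`: the surjectivity of `𝔪ʳ → xʳA/JA`;
* `length_quotient_weakTransform_map_lt_of_not_le` — **the colength drops at every prime `Q` of
  the chart**: `λ(A_Q/JᴬA_Q) ≤ λ_A(A/Jᴬ) < λ_R(R/J)`.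

References: J. Giraud, *Forme normale d'une fonction sur une surface de caractéristique
positive*, Bull. SMF 111 (1983), Lemme 2.1.1; V. Kodiyalam, *Integrally closed modules over
two-dimensional regular local rings*, Trans. AMS 347 (1995), Thm. 4.5; C. Huneke, I. Swanson,
*Integral Closure of Ideals, Rings, and Modules* (2006), Lemma 14.3.4.
-/

set_option linter.dupNamespace false

noncomputable section

open IsLocalRing Polynomial Literature.AlgebraicGeometry.Resolution

namespace Summit.ResolutionOfSingularities.ResolutionOfSingularities.Theorems.PfaffLine

section Abstract

variable {R : Type*} [CommRing R] [IsLocalRing R] {S : Type*} [CommRing S] [Algebra R S] {x : R}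

/-- **Huneke–Swanson 14.3.4, abstract form with the surjectivity of `𝔪ʳ → xʳS/JS` as a
hypothesis.** Let `R → S` with `𝔪S = xS`, `J ⊆ 𝔪ʳ` (`r ≥ 1`) of finite colength, and suppose
every `xʳ s` (`s ∈ S`) is congruent modulo `JS` to the image of an element of `𝔪ʳ`. Then
`λ_S(S/(JS : xʳ)) < λ_R(R/J)`: `S/(JS : xʳ) ≅ xʳS/JS` is a quotient of `𝔪ʳ/J ⊊ R/J`.
[cite: HunekeSwanson2006, Lemma 14.3.4] -/
theorem length_quotient_transform_lt_of_forall_exists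
    (hmS : (maximalIdeal R).map (algebraMap R S) = Ideal.span {algebraMap R S x})
    {J : Ideal R} {r : ℕ} (hr : 1 ≤ r) (hJ : J ≤ maximalIdeal R ^ r)
    (hsurj : ∀ s : S, ∃ m ∈ maximalIdeal R ^ r,
      algebraMap R S x ^ r * s - algebraMap R S m ∈ J.map (algebraMap R S))
    (hfin : IsFiniteLength R (R ⧸ J)) :
    Module.length S (S ⧸ (J.map (algebraMap R S)).colon {algebraMap R S x ^ r}) <
      Module.length R (R ⧸ J) := by
  obtain ⟨hNoeth, hArt⟩ := isFiniteLength_iff_isNoetherian_isArtinian.mp hfin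
  set x' : S := algebraMap R S x
  set JS : Ideal S := J.map (algebraMap R S)
  -- `σ : S → S/JS`, `s ↦ xʳ s`, with kernel `(JS : xʳ)`
  let σ : S →ₗ[S] S ⧸ JS := (Submodule.mkQ JS).comp (LinearMap.mulLeft S (x' ^ r))
  have hσ : ∀ s, σ s = Submodule.Quotient.mk (x' ^ r * s) := fun s => rfl
  have hkerσ : LinearMap.ker σ = JS.colon {x' ^ r} := by
    ext s
    rw [LinearMap.mem_ker, hσ, Submodule.Quotient.mk_eq_zero, Submodule.mem_colon_singleton,
      smul_eq_mul, mul_comm]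
  -- `θ : 𝔪ʳ → S/JS`, `m ↦ m`, with the same range
  let θ : ↥(maximalIdeal R ^ r) →ₗ[R] S ⧸ JS :=
    ((Submodule.mkQ JS).restrictScalars R).comp
      ((Algebra.linearMap R S).comp (maximalIdeal R ^ r).subtype)
  have hθ : ∀ m, θ m = Submodule.Quotient.mk (algebraMap R S m) := fun m => rfl
  have hrange : (LinearMap.range σ).restrictScalars R = LinearMap.range θ := by
    ext t
    rw [Submodule.restrictScalars_mem, LinearMap.mem_range, LinearMap.mem_range]
    constructor
    · rintro ⟨s, rfl⟩
      obtain ⟨m, hm, hdiff⟩ := hsurj s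
      refine ⟨⟨m, hm⟩, ?_⟩
      rw [hθ, hσ]
      exact ((Submodule.Quotient.eq JS).mpr hdiff).symm
    · rintro ⟨m, rfl⟩
      have hm' : algebraMap R S m ∈ Ideal.span {x' ^ r} := by
        rw [← Ideal.span_singleton_pow, ← hmS, ← Ideal.map_pow]
        exact Ideal.mem_map_of_mem _ m.2
      obtain ⟨s, hs⟩ := Ideal.mem_span_singleton'.mp hm'
      refine ⟨s, ?_⟩
      rw [hσ, hθ, ← hs, mul_comm]
  -- `ι : 𝔪ʳ → R/J` with `ker ι ≤ ker θ` and `range ι = 𝔪ʳ/J ⊊ R/J`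
  let ι : ↥(maximalIdeal R ^ r) →ₗ[R] R ⧸ J := (Submodule.mkQ J).comp (maximalIdeal R ^ r).subtype
  have hι : ∀ m, ι m = Submodule.Quotient.mk (m : R) := fun m => rfl
  have hker : LinearMap.ker ι ≤ LinearMap.ker θ := by
    intro m hm
    rw [LinearMap.mem_ker, hι, Submodule.Quotient.mk_eq_zero] at hm
    rw [LinearMap.mem_ker, hθ, Submodule.Quotient.mk_eq_zero]
    exact Ideal.mem_map_of_mem _ hm
  have hrangeι : LinearMap.range ι ≠ ⊤ := by
    intro htop
    have h1 : (Submodule.Quotient.mk 1 : R ⧸ J) ∈ LinearMap.range ι := htop ▸ Submodule.mem_top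
    obtain ⟨m, hm⟩ := LinearMap.mem_range.mp h1
    rw [hι, Submodule.Quotient.eq] at hm
    have h2 : (1 : R) ∈ maximalIdeal R ^ r := by
      have := sub_mem m.2 (hJ hm)
      rwa [sub_sub_cancel] at this
    exact (Ideal.ne_top_iff_one _).mp
      (ne_top_of_le_ne_top (maximalIdeal.isMaximal R).ne_top (Ideal.pow_le_self (by omega))) h2
  have hlenθ : Module.length R (LinearMap.range θ) ≤ Module.length R (LinearMap.range ι) := by
    rw [← (LinearMap.quotKerEquivRange θ).length_eq, ← (LinearMap.quotKerEquivRange ι).length_eq]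
    exact Module.length_le_of_surjective _ (Submodule.factor_surjective hker)
  -- assemble
  haveI := hNoeth
  haveI := hArt
  calc Module.length S (S ⧸ JS.colon {x' ^ r})
      = Module.length S (S ⧸ LinearMap.ker σ) := by rw [hkerσ]
    _ = Module.length S (LinearMap.range σ) := (LinearMap.quotKerEquivRange σ).length_eq
    _ ≤ Module.length R ((LinearMap.range σ).restrictScalars R) :=
        Submodule.length_le_length_restrictScalars R _
    _ = Module.length R (LinearMap.range θ) := by rw [hrange]
    _ ≤ Module.length R (LinearMap.range ι) := hlenθ
    _ < Module.length R (R ⧸ J) := Submodule.length_lt hrangeι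

end Abstract

section Chart

variable {K : Type*} [Field K] {R : Subring K} [IsLocalRing R] {x y : R}

/-- For `𝔪 = (x, y)` in a local subring `R ⊆ K`: every `g ∈ 𝔪ᵉ` is `xᵉ · F(y/x)` for a
polynomial `F ∈ R[X]` of degree `≤ e` (same computation as the private
`exists_eq_pow_mul_aeval_strictTransform` of `ValuativeLuAlphaPTorsorStrictTransform.lean`).
[folklore] -/
theorem exists_eq_pow_mul_aeval_colengthDrop (hm : maximalIdeal R = Ideal.span {x, y})
    (hx0 : ((x : R) : K) ≠ 0) :
    ∀ (e : ℕ) (g : R), g ∈ maximalIdeal R ^ e →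
      ∃ F : R[X], F.natDegree ≤ e ∧
        (g : K) = ((x : R) : K) ^ e * aeval (((y : R) : K) / ((x : R) : K)) F := by
  intro e
  induction e with
  | zero =>
    intro g _
    refine ⟨C g, by simp, ?_⟩
    rw [aeval_C, pow_zero, one_mul]
    rfl
  | succ e ih =>
    intro g hg
    rw [pow_succ] at hg
    refine Submodule.smul_induction_on (p := fun r : R => ∃ F : R[X], F.natDegree ≤ e + 1 ∧
      (r : K) = ((x : R) : K) ^ (e + 1) * aeval (((y : R) : K) / ((x : R) : K)) F) hg ?_ ?_
    · intro m hm' n hn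
      obtain ⟨F, hF, hmF⟩ := ih m hm'
      rw [hm, Ideal.mem_span_pair] at hn
      obtain ⟨a, b, rfl⟩ := hn
      refine ⟨C a * F + C b * F * X, ?_, ?_⟩
      · refine natDegree_add_le_of_degree_le ((natDegree_C_mul_le a F).trans (by omega)) ?_
        exact natDegree_mul_le.trans
          (add_le_add ((natDegree_C_mul_le b F).trans hF) natDegree_X_le)
      · rw [smul_eq_mul, Subring.coe_mul, hmF, Subring.coe_add, Subring.coe_mul,
          Subring.coe_mul]
        simp only [map_add, map_mul, aeval_C, aeval_X]
        rw [show (algebraMap R K a : K) = a from rfl, show (algebraMap R K b : K) = b from rfl]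
        field_simp
        ring
    · rintro r s ⟨F, hF, hrF⟩ ⟨G, hG, hsG⟩
      refine ⟨F + G, natDegree_add_le_of_degree_le hF hG, ?_⟩
      rw [Subring.coe_add, hrF, hsG, map_add, mul_add]

/-- For `𝔪 = (x, y)` and `G ∈ R[X]` of degree `≤ n`: `xⁿ G(y/x) = ι(Σ Gᵢ yⁱ xⁿ⁻ⁱ) ∈ ι(𝔪ⁿ)` in
the chart `A = R[y/x]` (`ι = chartIncl x y`). [folklore] -/
theorem exists_chartIncl_eq_pow_mul_aeval (hm : maximalIdeal R = Ideal.span {x, y}) (hx0 : x ≠ 0)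
    {G : R[X]} {n : ℕ} (hG : G.natDegree ≤ n) :
    ∃ b ∈ maximalIdeal R ^ n, chartIncl x y b = chartIncl x y x ^ n *
      (⟨aeval (((y : R) : K) / ((x : R) : K)) G, Polynomial.aeval_mem_adjoin_singleton R _⟩ :
        chartAdjoin (K := K) x y) := by
  have hx0K : ((x : R) : K) ≠ 0 := fun e => hx0 (Subtype.ext e)
  have hxm : x ∈ maximalIdeal R := hm ▸ Ideal.subset_span (by simp)
  have hym : y ∈ maximalIdeal R := hm ▸ Ideal.subset_span (by simp)
  set u : K := ((y : R) : K) / ((x : R) : K) with hu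
  refine ⟨∑ i ∈ Finset.range (n + 1), G.coeff i * y ^ i * x ^ (n - i), ?_, Subtype.ext ?_⟩
  · refine Ideal.sum_mem _ fun i hi => ?_
    have hi' : i ≤ n := Nat.lt_succ_iff.mp (Finset.mem_range.mp hi)
    have h1 : y ^ i * x ^ (n - i) ∈ maximalIdeal R ^ n := by
      have := Ideal.mul_mem_mul (Ideal.pow_mem_pow hym i) (Ideal.pow_mem_pow hxm (n - i))
      rwa [← pow_add, Nat.add_sub_cancel' hi'] at this
    rw [mul_assoc]
    exact Ideal.mul_mem_left _ _ h1
  · change ((∑ i ∈ Finset.range (n + 1), G.coeff i * y ^ i * x ^ (n - i) : R) : K) =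
      ((x : R) : K) ^ n * aeval u G
    rw [Polynomial.aeval_eq_sum_range' (Nat.lt_succ_of_le hG), AddSubmonoidClass.coe_finsetSum,
      Finset.mul_sum]
    refine Finset.sum_congr rfl fun i hi => ?_
    have hi' : i ≤ n := Nat.lt_succ_iff.mp (Finset.mem_range.mp hi)
    rw [Subring.coe_mul, Subring.coe_mul, Subring.coe_pow, Subring.coe_pow, Algebra.smul_def,
      Algebra.algebraMap_ofSubsemiring_apply, hu, div_pow]
    have e : ((x : R) : K) ^ n = ((x : R) : K) ^ i * ((x : R) : K) ^ (n - i) := by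
      rw [← pow_add, Nat.add_sub_cancel' hi']
    rw [e]
    field_simp

/-- **The reduction map `A = R[y/x] → A/xA ≅ κ[X]`** of the chart (`𝔪 = (x, y)`, `x ∣ yt ⇒ x ∣ t`):
a surjective ring homomorphism `φ : A → κ[X]` with `φ(G(y/x)) = Ḡ` whose kernel lies in `xA`
(`A ≅ R[X]/(xX − y)`, `ker_aevalCod_le`; same construction as in
`ValuativeLuAlphaPTorsorStrictTransform.lean`). [folklore] -/
theorem exists_reduction_chartAdjoin (hm : maximalIdeal R = Ideal.span {x, y}) (hx0 : x ≠ 0)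
    (hpq : ∀ t, x ∣ y * t → x ∣ t) :
    ∃ φ : chartAdjoin (K := K) x y →+* (ResidueField R)[X], Function.Surjective φ ∧
      (∀ G : R[X], φ ⟨aeval (((y : R) : K) / ((x : R) : K)) G,
        Polynomial.aeval_mem_adjoin_singleton R _⟩ = map (residue R) G) ∧
      ∀ a, φ a = 0 → a ∈ Ideal.span {chartIncl x y x} := by
  set u : K := ((y : R) : K) / ((x : R) : K) with hu
  set ψ : R[X] →+* chartAdjoin (K := K) x y :=
    (aeval u).toRingHom.codRestrict (Algebra.adjoin R {u}).toSubring
      (fun _ => Polynomial.aeval_mem_adjoin_singleton R u) with hψdef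
  have hψ : Function.Surjective ψ := aevalCod_surjective R u _
  set ρ : R[X] →+* (ResidueField R)[X] := mapRingHom (residue R) with hρ
  have hρker : ∀ p : R[X], ρ p = 0 ↔ ∀ i, p.coeff i ∈ maximalIdeal R := fun p => by
    rw [Polynomial.ext_iff]
    refine forall_congr' fun i => ?_
    rw [hρ, coe_mapRingHom, coeff_map, coeff_zero, residue_eq_zero_iff]
  have hker : RingHom.ker ψ ≤ RingHom.ker ρ := by
    intro p hp
    have hp' := ker_aevalCod_le hx0 hpq _ hp
    rw [RingHom.mem_ker, hρker]
    intro i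
    rw [hm]
    exact Ideal.mem_map_C_iff.mp hp' i
  set φ : chartAdjoin (K := K) x y →+* (ResidueField R)[X] :=
    ψ.liftOfSurjective hψ ⟨ρ, hker⟩ with hφdef
  have hφψ : ∀ p, φ (ψ p) = ρ p := fun p => ψ.liftOfSurjective_comp_apply hψ ⟨ρ, hker⟩ p
  refine ⟨φ, fun q => ?_, fun G => hφψ G, fun a ha => ?_⟩
  · obtain ⟨p, hp⟩ := map_surjective (residue R) residue_surjective q
    exact ⟨ψ p, by rw [hφψ, hρ, coe_mapRingHom, hp]⟩
  · obtain ⟨p, rfl⟩ := hψ a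
    rw [hφψ, hρker] at ha
    have h1 : ψ p ∈ (maximalIdeal R).map (chartIncl (K := K) x y) :=
      aeval_mem_map_incl_of_coeff_mem ha
    rwa [map_maximalIdeal_chartIncl hm hx0] at h1

/-- **Division by the initial form.** Let `φ : A → κ[X]` be the reduction map of the chart
`A = R[y/x]` (`𝔪 = (x, y)`) and `P ∈ A` with `φ P ≠ 0` of degree `≤ r`. Then every `a ∈ A` is
`a = Pq + s + xa'` with `xʳ s = ι(b)`, `b ∈ 𝔪ʳ`: divide `φ a` by `φ P` in `κ[X]`, lift the
remainder (degree `< r`) to `G ∈ R[X]` of degree `≤ r`, `s = G(y/x)`. [folklore] -/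
theorem exists_eq_mul_add_add_of_degree_le (hm : maximalIdeal R = Ideal.span {x, y}) (hx0 : x ≠ 0)
    {φ : chartAdjoin (K := K) x y →+* (ResidueField R)[X]} (hφs : Function.Surjective φ)
    (hφ : ∀ G : R[X], φ ⟨aeval (((y : R) : K) / ((x : R) : K)) G,
      Polynomial.aeval_mem_adjoin_singleton R _⟩ = map (residue R) G)
    (hker : ∀ a, φ a = 0 → a ∈ Ideal.span {chartIncl x y x}) {r : ℕ}
    {P : chartAdjoin (K := K) x y} (hP0 : φ P ≠ 0) (hPr : (φ P).degree ≤ r)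
    (a : chartAdjoin (K := K) x y) :
    ∃ (q s a' : chartAdjoin (K := K) x y) (b : R), b ∈ maximalIdeal R ^ r ∧
      chartIncl x y x ^ r * s = chartIncl x y b ∧ a = P * q + s + chartIncl x y x * a' := by
  -- Euclidean division of `φ a` by `φ P`, and lifts of quotient and remainder
  obtain ⟨q, hq⟩ := hφs (φ a / φ P)
  have hdeg : (φ a % φ P).degree < r := (degree_mod_lt (φ a) hP0).trans_le hPr
  have hlifts : φ a % φ P ∈ lifts (residue R) :=
    (lifts_iff_set_range _).mpr (map_surjective (residue R) residue_surjective _)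
  obtain ⟨G, hG, hGdeg⟩ := exists_degree_eq_of_mem_lifts hlifts
  have hGr : G.natDegree ≤ r := natDegree_le_iff_degree_le.mpr (hGdeg ▸ hdeg.le)
  obtain ⟨b, hb, hbs⟩ := exists_chartIncl_eq_pow_mul_aeval (K := K) hm hx0 hGr
  set s : chartAdjoin (K := K) x y :=
    ⟨aeval (((y : R) : K) / ((x : R) : K)) G, Polynomial.aeval_mem_adjoin_singleton R _⟩ with hs
  -- `a - Pq - s ∈ ker φ ⊆ xA`
  have hzero : φ (a - P * q - s) = 0 := by
    rw [map_sub, map_sub, map_mul, hq, hs, hφ G, hG]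
    linear_combination (-1 : (ResidueField R)[X]) * EuclideanDomain.div_add_mod (φ a) (φ P)
  obtain ⟨a', ha'⟩ := Ideal.mem_span_singleton'.mp (hker _ hzero)
  refine ⟨q, s, a', b, hb, hbs.symm, ?_⟩
  linear_combination (-1 : chartAdjoin (K := K) x y) * ha'

end Chart

section Surj

variable {K : Type*} [Field K] {R : Subring K} [IsRegularLocalRing R] {x y : R}

/-- **`xʳA ⊆ JA + ι(𝔪ʳ)` — the surjectivity of `𝔪ʳ → xʳA/JA` without genericity hypothesis**
(Giraud 1983, Lemme 2.1.1; Kodiyalam 1995, Thm. 4.5). For `J ⊆ 𝔪ʳ`, `J ⊄ 𝔪ʳ⁺¹` of finite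
colength and `f ∈ J ∖ 𝔪ʳ⁺¹`: `ι f = xʳ P` with `φ P ≠ 0` of degree `≤ r` (`𝔪ʳ⁺¹` is contracted
from `A`), so division by the initial form gives `xʳA ⊆ JA + ι(𝔪ʳ) + xʳ⁺¹A`, by iteration
`xʳA ⊆ JA + ι(𝔪ʳ) + xʳ⁺ⁿA` for all `n`, and `xᴺ ∈ J` for some `N` (`R/J` is Artinian).
[cite: HunekeSwanson2006, Lemma 14.3.4] -/
theorem exists_pow_mul_sub_mem_map (hdim : ringKrullDim R = 2)
    (hm : maximalIdeal R = Ideal.span {x, y}) (hx0 : x ≠ 0) {J : Ideal R} {r : ℕ}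
    (hJ : J ≤ maximalIdeal R ^ r) (hJr : ¬ J ≤ maximalIdeal R ^ (r + 1))
    (hfin : IsFiniteLength R (R ⧸ J)) (a : chartAdjoin (K := K) x y) :
    ∃ m ∈ maximalIdeal R ^ r,
      chartIncl x y x ^ r * a - chartIncl x y m ∈ J.map (chartIncl (K := K) x y) := by
  letI : Algebra R (chartAdjoin (K := K) x y) := (chartIncl x y).toAlgebra
  have halg : algebraMap R (chartAdjoin (K := K) x y) = chartIncl x y := rfl
  have hxm : x ∈ maximalIdeal R := hm ▸ Ideal.subset_span (by simp)
  have hx2 := fst_not_mem_sq hdim hm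
  have hx0K : ((x : R) : K) ≠ 0 := fun e => hx0 (Subtype.ext e)
  have hinj : Function.Injective (algebraMap R (chartAdjoin (K := K) x y)) :=
    chartIncl_injective x y
  have hmS : (maximalIdeal R).map (algebraMap R (chartAdjoin (K := K) x y)) =
      Ideal.span {algebraMap R _ x} := map_maximalIdeal_chartIncl hm hx0
  have hS2 := exists_pow_mul_eq_chartIncl (K := K) hm hx0
  -- `x` is prime and does not divide `y`: `x ∣ yt ⇒ x ∣ t`
  have hxp : Prime x := IsRegularLocalRing.prime_of_not_mem_sq hxm hx2
  have hxy : ¬ x ∣ y := by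
    intro hdvd
    apply maximalIdeal_ne_span_singleton hdim x
    rw [hm]
    apply le_antisymm
    · rw [Ideal.span_le]
      rintro _ (rfl | rfl)
      · exact Ideal.mem_span_singleton_self _
      · exact Ideal.mem_span_singleton.mpr hdvd
    · exact Ideal.span_mono (Set.singleton_subset_iff.mpr (Set.mem_insert _ _))
  have hpq : ∀ t, x ∣ y * t → x ∣ t := fun t ht => (hxp.dvd_or_dvd ht).resolve_left hxy
  -- the reduction map and the initial form `φ P` of an `f ∈ J ∖ 𝔪ʳ⁺¹`
  obtain ⟨φ, hφs, hφ, hker⟩ := exists_reduction_chartAdjoin (K := K) hm hx0 hpq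
  obtain ⟨f, hfJ, hfr⟩ := Set.not_subset.mp hJr
  obtain ⟨F, hFdeg, hfF⟩ := exists_eq_pow_mul_aeval_colengthDrop hm hx0K r f (hJ hfJ)
  set P : chartAdjoin (K := K) x y :=
    ⟨aeval (((y : R) : K) / ((x : R) : K)) F, Polynomial.aeval_mem_adjoin_singleton R _⟩ with hPdef
  have hP : chartIncl x y x ^ r * P = chartIncl x y f := Subtype.ext (by
    change ((x : R) : K) ^ r * aeval (((y : R) : K) / ((x : R) : K)) F = (f : K)
    exact hfF.symm)
  have hP0 : φ P ≠ 0 := by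
    intro h0
    obtain ⟨c, hc⟩ := Ideal.mem_span_singleton'.mp (hker P h0)
    apply hfr
    change f ∈ maximalIdeal R ^ (r + 1)
    rw [← comap_map_pow_maximalIdeal hxm hx2 hinj hmS hS2 (r + 1), Ideal.mem_comap,
      map_pow_maximalIdeal_eq_span hmS, Ideal.mem_span_singleton', halg, ← hP, ← hc]
    exact ⟨c, by ring⟩
  have hPr : (φ P).degree ≤ r := by
    rw [hPdef, hφ F]
    exact degree_map_le.trans (degree_le_of_natDegree_le hFdeg)
  -- iteration: `xʳ a ∈ JA + ι(𝔪ʳ) + xʳ⁺ⁿ A` for all `n`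
  have key : ∀ n : ℕ, ∀ a : chartAdjoin (K := K) x y, ∃ m ∈ maximalIdeal R ^ r,
      ∃ a' : chartAdjoin (K := K) x y, chartIncl x y x ^ r * a - chartIncl x y m -
        chartIncl x y x ^ (r + n) * a' ∈ J.map (chartIncl (K := K) x y) := by
    intro n
    induction n with
    | zero =>
      intro a
      refine ⟨0, Submodule.zero_mem _, a, ?_⟩
      rw [map_zero, add_zero, sub_zero, sub_self]
      exact zero_mem _
    | succ n ih =>
      intro a
      obtain ⟨m, hm', a', h⟩ := ih a
      obtain ⟨q, s, a'', b, hb, hbs, he⟩ :=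
        exists_eq_mul_add_add_of_degree_le hm hx0 hφs hφ hker hP0 hPr a'
      refine ⟨m + x ^ n * b, add_mem hm' (Ideal.mul_mem_left _ _ hb), a'', ?_⟩
      have e2 : chartIncl x y x ^ r * a - chartIncl x y (m + x ^ n * b) -
          chartIncl x y x ^ (r + (n + 1)) * a'' =
          (chartIncl x y x ^ r * a - chartIncl x y m - chartIncl x y x ^ (r + n) * a') +
            chartIncl x y x ^ n * q * chartIncl x y f := by
        rw [map_add, map_mul, map_pow, ← hbs, ← hP, he]
        ring
      rw [e2]
      exact add_mem h (Ideal.mul_mem_left _ _ (Ideal.mem_map_of_mem _ hfJ))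
  -- termination: `xᴺ ∈ J`
  obtain ⟨-, hArt⟩ := isFiniteLength_iff_isNoetherian_isArtinian.mp hfin
  haveI : IsArtinianRing (R ⧸ J) := isArtinian_of_tower R hArt
  obtain ⟨N, hN⟩ := exists_maximalIdeal_pow_le_of_isArtinianRing_quotient J
  have hxN : x ^ N ∈ J := hN (Ideal.pow_mem_pow hxm N)
  obtain ⟨m, hm', a', h⟩ := key N a
  refine ⟨m, hm', ?_⟩
  have e3 : chartIncl x y x ^ r * a - chartIncl x y m =
      (chartIncl x y x ^ r * a - chartIncl x y m - chartIncl x y x ^ (r + N) * a') +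
        chartIncl x y x ^ r * a' * chartIncl x y (x ^ N) := by
    rw [map_pow]; ring
  rw [e3]
  exact add_mem h (Ideal.mul_mem_left _ _ (Ideal.mem_map_of_mem _ hxN))

end Surj

open IsLocalRing

/-- **The colength of the weak transform drops at every point of the chart** (Giraud 1983,
Lemme 2.1.1; Kodiyalam 1995, Thm. 4.5; hypothesis-free form of Huneke–Swanson 14.3.4): for a
two-dimensional regular local ring `(R, 𝔪 = (x, y))` of `K`, an ideal `J ⊆ 𝔪ʳ`, `J ⊄ 𝔪ʳ⁺¹`
(`r ≥ 1`) of finite colength and every prime `Q` of `A = R[y/x]`: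
`λ_{A_Q}(A_Q/(JA : xʳ)A_Q) < λ_R(R/J)` — `A/(JA : xʳ) ≅ xʳA/JA` is an `R`-quotient of `𝔪ʳ/J`
(`exists_pow_mul_sub_mem_map`), and localisation does not increase length.
[cite: HunekeSwanson2006, Lemma 14.3.4] -/
theorem length_quotient_weakTransform_map_lt_of_not_le : ∀ {K : Type} [Field K] {R : Subring K} [IsRegularLocalRing R] {x y : R}, ringKrullDim R = 2 → maximalIdeal R = Ideal.span {x, y} → x ≠ 0 → ∀ {J : Ideal R} {r : ℕ}, 1 ≤ r → J ≤ maximalIdeal R ^ r → ¬ J ≤ maximalIdeal R ^ (r + 1) → IsFiniteLength R (R ⧸ J) → ∀ (Q : Ideal (Literature.AlgebraicGeometry.Resolution.chartAdjoin (K := K) x y)) [Q.IsPrime], Module.length (LocalSubring.ofPrime (Literature.AlgebraicGeometry.Resolution.chartAdjoin (K := K) x y) Q).toSubring ((LocalSubring.ofPrime (Literature.AlgebraicGeometry.Resolution.chartAdjoin (K := K) x y) Q).toSubring ⧸ (Literature.AlgebraicGeometry.Resolution.weakTransformChart x y J r).map (algebraMap (Literature.AlgebraicGeometry.Resolution.chartAdjoin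 (K := K) x y) (LocalSubring.ofPrime (Literature.AlgebraicGeometry.Resolution.chartAdjoin (K := K) x y) Q).toSubring)) < Module.length R (R ⧸ J) := by
  intro K _ R _ x y hdim hm hx0 J r hr hJ hJr hfin Q _
  letI : Algebra R (chartAdjoin (K := K) x y) := (chartIncl x y).toAlgebra
  have hmS : (maximalIdeal R).map (algebraMap R (chartAdjoin (K := K) x y)) =
      Ideal.span {algebraMap R _ x} := map_maximalIdeal_chartIncl hm hx0
  have h1 := length_quotient_transform_lt_of_forall_exists (S := chartAdjoin (K := K) x y) hmS hr
    hJ (exists_pow_mul_sub_mem_map hdim hm hx0 hJ hJr hfin) hfin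
  exact (length_quotient_map_le_of_isLocalization Q _).trans_lt h1

end Summit.ResolutionOfSingularities.ResolutionOfSingularities.Theorems.PfaffLine

end
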